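import Literature.AnabelianGeometry.EtaleTheta.Setting
import Literature.AnabelianGeometry.SemiGraphs.TemperedCurveGaloisInfinite
import Literature.AnabelianGeometry.EtaleTheta.CyclotomeZHatEquiv
import Literature.AnabelianGeometry.AbsoluteAnabelian.GaloisCyclotomeZHatOne
import Literature.AnabelianGeometry.AbsoluteAnabelian.GaloisCyclotomeAction
import Literature.AnabelianGeometry.AbsoluteAnabelian.MLFGaloisTypeProofs
import Literature.NumberTheory.GaloisRepresentations.CohomologicalDimension
import Mathlib.FieldTheory.KrullTopology
import HarnessLib

/-!
# Junction `G_K ≤ G_{ℚ_p}` ↔ `Gal(K^al/K)`: the group-theoretic cyclotome `μ_Ẑ(G_K)` of the [EtTh] theta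
# setting IS `Λ(ℚ̄_pˣ) ≅ Ẑ`, `G_K`-equivariantly (proof-only; GAP-LEDGER row G-w5d145-1, junction J)

Mochizuki, *The étale theta function …*, Publ. RIMS **45** (2009) [EtTh] §1, PRIMS p. 12 («`Δ_Θ (≅ Ẑ(1))`»,
with `G_K = Gal(ℚ̄_p/K)`, `K ⊆ ℚ̄_p` finite over `ℚ_p`, p. 11) [cite: MochizukiEtTh2009, §1 p.12]; Mochizuki,
*Topics in absolute anabelian geometry III*, Cor. 1.10 (i)(a) p. 41–42 («`μ_Ẑ(G_k)`») and *The absolute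
anabelian geometry of hyperbolic curves* [AbsAnab] Prop. 1.2.1 (vi)(vii) p. 10. abc-iut cell, seat
abc-iut-w6-d047 (block C); JUNCTION between
* the [EtTh] §1 theta setting's Galois group `D.GK = K.fixingSubgroup ≤ G_{ℚ_p} = Gal(ℚ̄_p/ℚ_p)`
  (`EtaleTheta/Setting.lean`, `SemiGraphs.TemperedCurve.GK`), with its subspace Krull topology, and
* Mathlib's `Field.absoluteGaloisGroup K = Gal(K^al/K)`, on which the tree's local class field theory proves
  `μ_Ẑ(Gal(K^al/K)) ≅ Λ((K^al)ˣ)` equivariantly (`exists_muZhat_mulEquiv_cyclotome_units_of_isMLF`,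
  abc-iut-L4, `GaloisCyclotomeZHatOne.lean`).

Contents (PROOF-ONLY — no `def`, no named `Prop` fact; every isomorphism is produced inside an `∃`/`Nonempty`):
* `continuous_fixingSubgroupEquiv`, `continuous_fixingSubgroupEquiv_symm`,
  `exists_fixingSubgroup_continuousMulEquiv` — for an ALGEBRAIC extension `E/F` and an intermediate field
  `K`, Mathlib's `IntermediateField.fixingSubgroupEquiv K : K.fixingSubgroup ≃* (E ≃ₐ[K] E)` is a
  homeomorphism for the Krull topologies (subspace of `Gal(E/F)` on the left, `Gal(E/K)` on the right);
* `muQZ.map_smul`, `muZhat.map_smul` — transport of `μ_{ℚ/ℤ}`, `μ_Ẑ` along `e : G ≃ₜ* G'` intertwines the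
  conjugation actions (`e g • _`);
* `exists_GK_continuousMulEquiv_absoluteGaloisGroup X` (every `X : SemiGraphs.TemperedCurve p`, the [SemiAnbd] §6
  interface the [EtTh] setting extends; `G_K` compact by `TemperedCurve.compactSpace_GK`, abc-iut-w5-d119) —
  `G_K ≃ₜ* Gal(K^al/K)` TOGETHER WITH a `K`-isomorphism `ι : K^al ≃ₐ[K] ℚ̄_p` intertwining the two actions
  («compatible with roots of unity»);
* `exists_muZhat_GK_mulEquiv_cyclotome X` — **`μ_Ẑ(G_K) ≃* Λ(ℚ̄_pˣ)`, `G_K`-equivariant** for the conjugation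
  action on the source and the tautological Galois action of `G_K ≤ G_{ℚ_p}` on `ℚ̄_p`;
* `nonempty_muZhat_GK_mulEquiv_zHat X` — **`μ_Ẑ(G_K) ≃* Ẑ`** (abstract groups), unconditionally
  (`Λ(ℚ̄_pˣ) ≃* Ẑ`: `cyclotome.nonempty_mulEquiv_zHat_of_isSepClosed`);
* `ThetaSetting.exists_GK_continuousMulEquiv_absoluteGaloisGroup`, `ThetaSetting.exists_muZhat_GK_mulEquiv_cyclotome`,
  `ThetaSetting.nonempty_muZhat_GK_mulEquiv_zHat` — the same for `D : EtaleTheta.ThetaSetting p` (`D.GK` is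
  `D.toTemperedCurve.GK`), the form consumed by the `Π`-side of [IUTchII] Cor. 1.11 at the genuine natural system
  (`IUT/HodgeArakelov/GaloisPairCyclotomesThetaSyncScalar`, conjunct (1) `Nonempty (μ_Ẑ(G_K) ≃* Ẑ)`).

HONEST FRAMING: classical Galois theory + bookkeeping over the tree's own constructions; nothing here bears on
[IUTchIII] Cor. 3.12; no side is taken; the theta setting is data quoting print, not asserted to exist.
-/

noncomputable section

open scoped Topology

/-! ## Part A. `K.fixingSubgroup ≃ₜ* Gal(E/K)` for an algebraic extension `E/F ⊇ K` -/

namespace Literature.AnabelianGeometry.EtaleTheta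

section FixingSubgroup

variable {F E : Type*} [Field F] [Field E] [Algebra F E] [Algebra.IsAlgebraic F E]
  (K : IntermediateField F E)

/-- An `R`-linear endomorphism of `E` fixing an `R`-basis of an intermediate field `M` (over `R`) fixes `M`
pointwise (private linear-algebra helper). [folklore] -/
private theorem apply_eq_self_of_basis {R : Type*} [Field R] [Algebra R E] {ι : Type*} (M : IntermediateField R E)
    (b : Module.Basis ι R M) (f : E →ₗ[R] E) (hb : ∀ i, f (b i) = b i) :
    ∀ x ∈ M, f x = x := by
  have key : f ∘ₗ M.val.toLinearMap = M.val.toLinearMap := b.ext fun i => hb i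
  intro x hx
  exact congr($key ⟨x, hx⟩)

/-- **`K.fixingSubgroup → Gal(E/K)` is continuous** (Krull topologies; `E/F` algebraic) — the identification
«`G(Ω|K) ≤ G(Ω|k)`» ↔ «the Galois group of `Ω|K`» of infinite Galois theory (Neukirch, *Algebraic Number Theory*,
Ch. IV §1, Thm. (1.2): `K ↦ G(Ω|K)`, closed subgroups) respects the Krull topologies: the preimage of `Gal(E/L)`,
`L/K` finite, contains `Gal(E/F(b)) ∩ G_K` for a `K`-basis `b` of `L`. [cite: NeukirchANT1999, Ch. IV §1 Thm (1.2) p.262] -/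
theorem continuous_fixingSubgroupEquiv :
    Continuous (IntermediateField.fixingSubgroupEquiv K : K.fixingSubgroup → (E ≃ₐ[K] E)) := by
  apply continuous_of_continuousAt_one _ (continuousAt_def.mpr _)
  intro N hN
  rw [map_one] at hN
  obtain ⟨L, hLfd, hL⟩ := (krullTopology_mem_nhds_one_iff K E N).mp hN
  haveI := hLfd
  let b := Module.finBasis K L
  let S : Set E := Set.range fun i => ((b i : L) : E)
  let M : IntermediateField F E := IntermediateField.adjoin F S
  haveI : FiniteDimensional F M :=
    IntermediateField.finiteDimensional_adjoin fun x _ => (Algebra.IsAlgebraic.isAlgebraic x).isIntegral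
  have hopen : IsOpen (Subtype.val ⁻¹' (M.fixingSubgroup : Set (E ≃ₐ[F] E)) : Set K.fixingSubgroup) :=
    M.fixingSubgroup_isOpen.preimage continuous_subtype_val
  refine Filter.mem_of_superset (hopen.mem_nhds (by simp)) fun σ hσ => hL ?_
  rw [Set.mem_preimage, SetLike.mem_coe, IntermediateField.mem_fixingSubgroup_iff] at hσ
  rw [SetLike.mem_coe, IntermediateField.mem_fixingSubgroup_iff]
  have hb : ∀ i, (IntermediateField.fixingSubgroupEquiv K σ).toLinearMap ((b i : L) : E) = (b i : L) :=
    fun i => hσ _ (IntermediateField.subset_adjoin F S ⟨i, rfl⟩)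
  exact apply_eq_self_of_basis L b _ hb

/-- **`Gal(E/K) → K.fixingSubgroup ≤ Gal(E/F)` is continuous** (restriction of scalars; `E/F` algebraic; the
converse direction of the same identification of Neukirch Ch. IV §1 Thm. (1.2)): the preimage of `Gal(E/M) ∩ G_K`,
`M/F` finite, contains `Gal(E/K(b))` for an `F`-basis `b` of `M`. [cite: NeukirchANT1999, Ch. IV §1 Thm (1.2) p.262] -/
theorem continuous_fixingSubgroupEquiv_symm :
    Continuous ((IntermediateField.fixingSubgroupEquiv K).symm : (E ≃ₐ[K] E) → K.fixingSubgroup) := by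
  refine Continuous.subtype_mk ?_ _
  -- the underlying map `Gal(E/K) → Gal(E/F)` is restriction of scalars, a group homomorphism
  let φ : (E ≃ₐ[K] E) →* (E ≃ₐ[F] E) :=
    { toFun := fun ψ => ((IntermediateField.fixingSubgroupEquiv K).symm ψ : K.fixingSubgroup)
      map_one' := by rw [map_one]; rfl
      map_mul' := fun _ _ => by rw [map_mul]; rfl }
  change Continuous φ
  apply continuous_of_continuousAt_one φ (continuousAt_def.mpr _)
  intro N hN
  rw [map_one] at hN
  obtain ⟨M, hMfd, hM⟩ := (krullTopology_mem_nhds_one_iff F E N).mp hN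
  haveI := hMfd
  let b := Module.finBasis F M
  let S : Set E := Set.range fun i => ((b i : M) : E)
  let L : IntermediateField K E := IntermediateField.adjoin K S
  haveI : Algebra.IsAlgebraic K E := Algebra.IsAlgebraic.tower_top (K := F) K
  haveI : FiniteDimensional K L :=
    IntermediateField.finiteDimensional_adjoin fun x _ => (Algebra.IsAlgebraic.isAlgebraic x).isIntegral
  refine (krullTopology_mem_nhds_one_iff K E _).mpr ⟨L, inferInstance, fun ψ hψ => hM ?_⟩
  rw [SetLike.mem_coe, IntermediateField.mem_fixingSubgroup_iff] at hψ
  rw [SetLike.mem_coe, IntermediateField.mem_fixingSubgroup_iff]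
  have hb : ∀ i, (φ ψ).toLinearMap ((b i : M) : E) = (b i : M) :=
    fun i => hψ _ (IntermediateField.subset_adjoin K S ⟨i, rfl⟩)
  exact apply_eq_self_of_basis M b _ hb

/-- **`K.fixingSubgroup ≃ₜ* Gal(E/K)`** as topological groups (`E/F` algebraic; infinite Galois theory,
Neukirch Ch. IV §1 Thm. (1.2): the closed subgroup `G(Ω|K)` of `G(Ω|k)` IS the Galois group of `Ω|K`, Krull
topologies included), the underlying group isomorphism being Mathlib's `IntermediateField.fixingSubgroupEquiv K`.
[cite: NeukirchANT1999, Ch. IV §1 Thm (1.2) p.262] -/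
theorem exists_fixingSubgroup_continuousMulEquiv :
    ∃ e : K.fixingSubgroup ≃ₜ* (E ≃ₐ[K] E), e.toMulEquiv = IntermediateField.fixingSubgroupEquiv K :=
  ⟨{ IntermediateField.fixingSubgroupEquiv K with
      continuous_toFun := continuous_fixingSubgroupEquiv K
      continuous_invFun := continuous_fixingSubgroupEquiv_symm K }, rfl⟩

end FixingSubgroup

end Literature.AnabelianGeometry.EtaleTheta

/-! ## Part B. Transport of `μ_{ℚ/ℤ}`, `μ_Ẑ` along `G ≃ₜ* G'` is equivariant -/

namespace Literature.AnabelianGeometry.AbsoluteAnabelian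

section MapSmul

universe u

variable {G : Type u} [Group G] [TopologicalSpace G] [IsTopologicalGroup G] [CompactSpace G]
  {G' : Type u} [Group G'] [TopologicalSpace G'] [IsTopologicalGroup G'] [CompactSpace G']

/-- Transport of `μ_{ℚ/ℤ}` along `e : G ≃ₜ* G'` intertwines the conjugation actions:
`μ(e)(g • z) = e(g) • μ(e)(z)` (both sides are transport along `x ↦ e(g x g⁻¹) = e(g) e(x) e(g)⁻¹`).
[cite: MochizukiAbsTopIII2015, Cor 1.10 (i) p.42] -/
theorem muQZ.map_smul (e : G ≃ₜ* G') (g : G) (z : muQZ G) :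
    muQZ.map e (g • z) = e g • muQZ.map e z := by
  rw [muQZ.smul_def, muQZ.smul_def, ← muQZ.map_trans, ← muQZ.map_trans]
  exact muQZ.map_congr (fun x => by simp [map_mul, map_inv]) z

/-- Transport of `μ_Ẑ` along `e : G ≃ₜ* G'` intertwines the conjugation actions:
`μ_Ẑ(e)(g • ζ) = e(g) • μ_Ẑ(e)(ζ)`. [cite: MochizukiAbsTopIII2015, Cor 1.10 (i) p.42] -/
theorem muZhat.map_smul (e : G ≃ₜ* G') (g : G) (ζ : muZhat G) :
    muZhat.map e (g • ζ) = e g • muZhat.map e ζ := by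
  apply Subtype.ext
  funext n
  rw [muZhat.map_apply_coe, muZhat.coe_smul_apply, muZhat.coe_smul_apply, muZhat.map_apply_coe,
    muQZ.toAdd_smul, muQZ.map_smul]
  rfl

end MapSmul

end Literature.AnabelianGeometry.AbsoluteAnabelian

/-! ## Part C. The [SemiAnbd] §6 / [EtTh] §1 interface: `G_K ≃ₜ* Gal(K^al/K)` and `μ_Ẑ(G_K) ≃* Λ(ℚ̄_pˣ) ≃* Ẑ` -/

namespace Literature.AnabelianGeometry.EtaleTheta

open Literature.AnabelianGeometry.SemiGraphs
open Literature.AnabelianGeometry.AbsoluteAnabelian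
open Literature.NumberTheory.GaloisRepresentations

section TemperedCurveJunction

variable {p : ℕ} [Fact p.Prime] (X : TemperedCurve p)

/-- **`G_K ≃ₜ* Gal(K^al/K)`, compatibly with a `K`-isomorphism `K^al ≅ ℚ̄_p`**: for `X : TemperedCurve p` with
base field `K ⊆ ℚ̄_p` there are a `K`-algebra isomorphism `ι : K^al ≃ₐ[K] ℚ̄_p` (uniqueness of algebraic
closures) and an isomorphism of topological groups `Φ : G_K ≃ₜ* Gal(K^al/K)` (`G_K = K.fixingSubgroup ≤ G_{ℚ_p}`
with the subspace Krull topology; Mathlib's `Field.absoluteGaloisGroup K`) such that `ι (Φ(σ) x) = σ (ι x)` for all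
`σ ∈ G_K`, `x ∈ K^al` — i.e. `Φ(σ) = ι⁻¹ ∘ σ ∘ ι`; in particular `Φ` matches the two actions on roots of unity.
[cite: MochizukiSemiAnbd2006, §6 p.69] -/
theorem exists_GK_continuousMulEquiv_absoluteGaloisGroup :
    ∃ (ι : AlgebraicClosure X.K ≃ₐ[X.K] PadicAlgCl p) (Φ : X.GK ≃ₜ* Field.absoluteGaloisGroup X.K),
      ∀ (σ : X.GK) (x : AlgebraicClosure X.K), ι (Φ σ • x) = (σ : GQp p) • ι x := by
  haveI := PadicAlgCl.isAlgClosure_subfield X.K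
  obtain ⟨e₁, he₁⟩ := exists_fixingSubgroup_continuousMulEquiv (F := ℚ_[p]) (E := PadicAlgCl p) X.K
  let ι₀ : PadicAlgCl p ≃ₐ[X.K] AlgebraicClosure X.K :=
    IsAlgClosure.equiv X.K (PadicAlgCl p) (AlgebraicClosure X.K)
  refine ⟨ι₀.symm, e₁.trans (algEquivContinuousMulEquivAbsoluteGaloisGroup X.K (PadicAlgCl p)), ?_⟩
  intro σ x
  have h1 : (e₁ σ : PadicAlgCl p ≃ₐ[X.K] PadicAlgCl p) = IntermediateField.fixingSubgroupEquiv X.K σ := by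
    rw [← he₁]; rfl
  change ι₀.symm (ι₀ ((e₁ σ) (ι₀.symm x))) = (σ : GQp p) (ι₀.symm x)
  rw [ι₀.symm_apply_apply, h1]
  rfl

/-- **`μ_Ẑ(G_K) ≃* Λ(ℚ̄_pˣ)`, `G_K`-equivariantly** ([SemiAnbd] §6 p. 71 «`Ẑ(1)`», [EtTh] §1 p. 12, [AbsTopIII]
Cor. 1.10 (i)(a) «`μ_Ẑ(G_k)`»): for `X : TemperedCurve p` there is a group isomorphism of abc-iut-L4's
group-theoretic cyclotome `μ_Ẑ(G_K)` (of the subgroup `G_K ≤ G_{ℚ_p}` with its own topology) with the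
inverse-limit cyclotome `Λ(ℚ̄_pˣ) = lim_n μ_n(ℚ̄_p)`, carrying the conjugation action of `G_K` on `μ_Ẑ(G_K)` to its
tautological Galois action on `ℚ̄_p` — local class field theory (`exists_muZhat_mulEquiv_cyclotome_units_of_isMLF`)
transported along `exists_GK_continuousMulEquiv_absoluteGaloisGroup`. [cite: MochizukiSemiAnbd2006, §6 p.71] -/
theorem exists_muZhat_GK_mulEquiv_cyclotome :
    haveI := X.compactSpace_GK
    ∃ e : muZhat X.GK ≃* cyclotome (PadicAlgCl p)ˣ,
      ∀ (σ : X.GK) (ζ : muZhat X.GK) (n : ℕ+),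
        ((((e (σ • ζ) : cyclotome (PadicAlgCl p)ˣ) : ℕ+ → (PadicAlgCl p)ˣ) n : (PadicAlgCl p)ˣ) :
            PadicAlgCl p) =
          (σ : GQp p) • ((((e ζ : cyclotome (PadicAlgCl p)ˣ) : ℕ+ → (PadicAlgCl p)ˣ) n : (PadicAlgCl p)ˣ) :
            PadicAlgCl p) := by
  haveI := X.compactSpace_GK
  haveI : FiniteDimensional ℚ_[p] X.K := X.finiteDimensional_K
  obtain ⟨ι, Φ, hΦ⟩ := exists_GK_continuousMulEquiv_absoluteGaloisGroup X
  obtain ⟨e₀, he₀⟩ := exists_muZhat_mulEquiv_cyclotome_units_of_isMLF (X.K : Type) (isMLF_padicSubfield X.K)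
  -- `Λ(ι) : Λ((K^al)ˣ) ≃* Λ(ℚ̄_pˣ)`
  let u : (AlgebraicClosure X.K)ˣ ≃* (PadicAlgCl p)ˣ := Units.mapEquiv ι.toMulEquiv
  let Λι : cyclotome (AlgebraicClosure X.K)ˣ ≃* cyclotome (PadicAlgCl p)ˣ :=
    { cyclotome.map u.toMonoidHom with
      invFun := cyclotome.map u.symm.toMonoidHom
      left_inv := fun ζ => Subtype.ext (funext fun n => by simp)
      right_inv := fun ζ => Subtype.ext (funext fun n => by simp) }
  refine ⟨(muZhat.congr Φ).trans (e₀.trans Λι), fun σ ζ n => ?_⟩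
  have hΛ : ∀ (ξ : cyclotome (AlgebraicClosure X.K)ˣ) (m : ℕ+),
      ((((Λι ξ : cyclotome (PadicAlgCl p)ˣ) : ℕ+ → (PadicAlgCl p)ˣ) m : (PadicAlgCl p)ˣ) : PadicAlgCl p) =
        ι ((((ξ : ℕ+ → (AlgebraicClosure X.K)ˣ) m : (AlgebraicClosure X.K)ˣ) : AlgebraicClosure X.K)) :=
    fun ξ m => rfl
  rw [MulEquiv.trans_apply, MulEquiv.trans_apply, MulEquiv.trans_apply, MulEquiv.trans_apply, hΛ, hΛ,
    muZhat.coe_congr, muZhat.map_smul, he₀, hΦ]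

/-- **`μ_Ẑ(G_K) ≅ Ẑ`** (abstract groups) for the Galois group `G_K ≤ G_{ℚ_p}` of every `X : TemperedCurve p`
([SemiAnbd] §6 p. 71 «`Ẑ(1)` [i.e., the profinite completion of `ℤ`, Tate twisted once]»; [AbsTopIII] Cor. 1.10
(i)(a) / [AbsAnab] Prop. 1.2.1 (vi)(vii) «`μ_Ẑ(G_k) ≅ Ẑ(1)`»), UNCONDITIONAL: `μ_Ẑ(G_K) ≃* Λ(ℚ̄_pˣ)`
(`exists_muZhat_GK_mulEquiv_cyclotome`) and `Λ(ℚ̄_pˣ) ≃* Ẑ` (`cyclotome.nonempty_mulEquiv_zHat_of_isSepClosed`);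
`Ẑ` = the tree's `SemiGraphs.ZHat` = Mathlib's profinite completion of `ℤ` (= `IUT.HodgeTheaters.ZHat` by `rfl`).
[cite: MochizukiSemiAnbd2006, §6 p.71] -/
theorem nonempty_muZhat_GK_mulEquiv_zHat :
    haveI := X.compactSpace_GK
    Nonempty (muZhat X.GK ≃* ZHat) := by
  obtain ⟨e, -⟩ := exists_muZhat_GK_mulEquiv_cyclotome X
  haveI : CharZero (PadicAlgCl p) :=
    charZero_of_injective_algebraMap (algebraMap ℚ_[p] (PadicAlgCl p)).injective
  obtain ⟨f⟩ := cyclotome.nonempty_mulEquiv_zHat_of_isSepClosed (PadicAlgCl p)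
  exact ⟨e.trans f⟩

end TemperedCurveJunction

/-! ### The same for the [EtTh] §1 theta setting (`D.GK` is `D.toTemperedCurve.GK`) -/

namespace ThetaSetting

variable {p : ℕ} [Fact p.Prime] (D : ThetaSetting p)

/-- `G_K ≃ₜ* Gal(K^al/K)` for the [EtTh] theta setting, compatibly with a `K`-isomorphism `ι : K^al ≃ₐ[K] ℚ̄_p`
(`ι (Φ(σ) x) = σ (ι x)`). [cite: MochizukiEtTh2009, §1 p.12] -/
theorem exists_GK_continuousMulEquiv_absoluteGaloisGroup :
    ∃ (ι : AlgebraicClosure D.K ≃ₐ[D.K] PadicAlgCl p) (Φ : D.GK ≃ₜ* Field.absoluteGaloisGroup D.K),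
      ∀ (σ : D.GK) (x : AlgebraicClosure D.K), ι (Φ σ • x) = (σ : GQp p) • ι x :=
  EtaleTheta.exists_GK_continuousMulEquiv_absoluteGaloisGroup D.toTemperedCurve

/-- **`μ_Ẑ(G_K) ≃* Λ(ℚ̄_pˣ)`, `G_K`-equivariantly**, for the [EtTh] theta setting ([EtTh] §1 p. 12 «`Ẑ(1)`» as a
`G_K`-module — the module behind «`Δ_Θ (≅ Ẑ(1))`»). [cite: MochizukiEtTh2009, §1 p.12] -/
theorem exists_muZhat_GK_mulEquiv_cyclotome :
    haveI := D.compactSpace_GK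
    ∃ e : muZhat D.GK ≃* cyclotome (PadicAlgCl p)ˣ,
      ∀ (σ : D.GK) (ζ : muZhat D.GK) (n : ℕ+),
        ((((e (σ • ζ) : cyclotome (PadicAlgCl p)ˣ) : ℕ+ → (PadicAlgCl p)ˣ) n : (PadicAlgCl p)ˣ) :
            PadicAlgCl p) =
          (σ : GQp p) • ((((e ζ : cyclotome (PadicAlgCl p)ˣ) : ℕ+ → (PadicAlgCl p)ˣ) n : (PadicAlgCl p)ˣ) :
            PadicAlgCl p) :=
  EtaleTheta.exists_muZhat_GK_mulEquiv_cyclotome D.toTemperedCurve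

/-- **`μ_Ẑ(G_K) ≅ Ẑ`** (abstract groups) for the Galois group `G_K` of every [EtTh] theta setting — the
abstract-isomorphism input «`μ_Ẑ(G_K) ≃* Ẑ`» of the `Π`-side of [IUTchII] Cor. 1.11 at the genuine natural system
(`IUT/HodgeArakelov/GaloisPairCyclotomesThetaSyncScalar`, `EtaleLevels.nonempty_galCyclotome_basePointLim_iff`),
UNCONDITIONAL. [cite: MochizukiEtTh2009, §1 p.12] -/
theorem nonempty_muZhat_GK_mulEquiv_zHat :
    haveI := D.compactSpace_GK
    Nonempty (muZhat D.GK ≃* ZHat) :=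
  EtaleTheta.nonempty_muZhat_GK_mulEquiv_zHat D.toTemperedCurve

end ThetaSetting

end Literature.AnabelianGeometry.EtaleTheta

end
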